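import Summits.HodgeConjecture.CorCM.MultiFieldWeilSeparatedThreefoldFactors
import Literature.AlgebraicGeometry.ComplexMultiplication.SimpleCMAbelianVarietyIsogenyClasses
import HarnessLib

/-!
# MULTI-FIELD WEIL ENGINE — ON THE VARIETY, WITNESSED FORM: the hypotheses of `CorCM/MultiFieldWeilSeparatedThreefoldFactors.lean` checked on ONE CM realisation of each
# simple factor (the CM field of a simple CM abelian variety is unique up to isomorphism)

Cell `pub-hodgecm2` (COR-CM), seat b30 gen 35 (2026-08-25); count-neutral own lane MULTI-FIELD WEIL ENGINE (stem `MultiFieldWeil*`).  Theorems only; no definition, no named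
fact, no `sorry`.  HONEST FRAMING: §0 is UNCONDITIONAL field theory; §1 is conditional on the displayed Markman fourfold binder only; `HC_CM` is NOT proved and not asserted.

THE POINT.  The previous file states its separation hypotheses for ALL CM realisations of the simple factors.  Since two realisations `B ⊨ (K; Φ)`, `B ⊨ (K′; Φ′)` of one
SIMPLE abelian variety have isomorphic fields (tree: `exists_ringEquiv_forall_mem_iff_of_isIsogenous`, Milne CM Prop. 3.13), and the Galois closure in `ℂ` and the
existence of an imaginary quadratic subfield embedding in a second field are invariant under field isomorphisms (§0), it suffices to check the hypotheses on ONE realisation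
per factor: §1 (**`hodgeConjectureFor_of_avDominatedBy_powSucc_of_isOfCMType_of_witnessed_separated_threefold_factors_of_markman`**) — `X` of CM type with simple factors of
dimension `≤ 3`; for any two non-isogenous simple threefold factors SOME realisations `B₀ ⊨ (K₀;Φ₀)`, `B₁ ⊨ (K₁;Φ₁)` with `L(K₀) ≠ L(K₁)` and no totally complex quadratic
`F ≤ K₀` embedding in `K₁`; for any three pairwise non-isogenous simple surface factors SOME realisations whose three fields do not share one Galois closure.  Then everything
dominated by a power of `X` satisfies the Hodge conjecture, GIVEN ONLY `Markman2025_weilClasses_algebraic_abelianFourfold`; likewise the «at most two threefold classes + no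
dihedral triple» variant.

[cite: MilneCM2006, Ch. I Prop. 3.13 (p. 30)] [cite: MoonenZarhin1999LowDim, Thm. (0.1), Thm. (0.2), §3 (3.1), Cor. (3.9)] [cite: Markman2025SurveySecant, Thm. 1.2]
[cite: Milne1999LefschetzClasses, §1 Prop. 1.1] [cite: Lang2002, VI §1 Thm. 1.1 and Cor. 1.6] [cite: MumfordAV1970, §19 Thm. 1, Cor. 1–2 and p. 169]

## References
* [MilneCM2006] J. S. Milne, *Complex Multiplication*, Ch. I Prop. 3.13.  [MoonenZarhin1999LowDim] B. Moonen, Yu. Zarhin, Math. Ann. 315 (1999) 711–733.  [Markman2025SurveySecant]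
  E. Markman, arXiv:2509.23403, Thm. 1.2.  [Milne1999LefschetzClasses] J. S. Milne, Duke Math. J. 96 (1999), §1 Prop. 1.1.  [Lang2002] S. Lang, *Algebra*, GTM 211, VI §1.
  [MumfordAV1970] D. Mumford, *Abelian Varieties*, §19.
-/

noncomputable section

open CategoryTheory CategoryTheory.Limits NumberField IntermediateField

namespace Summit.HodgeConjecture.CorCM.MultiFieldWeil

open Literature.AlgebraicGeometry Literature.AlgebraicGeometry.Motives Literature.AlgebraicGeometry.HodgeTheory
open Literature.AlgebraicGeometry.Motives.AbelianVariety
open Literature.AlgebraicGeometry.ComplexMultiplication (IsCMTypeRealisation exists_ringEquiv_forall_mem_iff_of_isIsogenous)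
open Literature.AlgebraicTopology.SingularHomology
open Literature.NumberTheory.ComplexMultiplication
open Literature.AlgebraicGeometry.Milne1999 (IsOfCMType)
open Summit.HodgeConjecture.CorCM.Domination

open scoped Classical

/-! ## §0 Invariance under field isomorphisms -/

section Transport

variable {K K' L L' : Type} [Field K] [NumberField K] [Field K'] [NumberField K'] [Field L] [NumberField L] [Field L'] [NumberField L']

/-- **Isomorphic number fields have the same Galois closure in `ℂ`** (the closure is the compositum of the images of all embeddings). [cite: Lang2002, VI §1 Thm. 1.1] -/
theorem normalClosure_eq_of_ringEquiv (ε : K ≃+* K') : normalClosure ℚ K ℂ = normalClosure ℚ K' ℂ := by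
  let εa : K ≃ₐ[ℚ] K' := AlgEquiv.ofRingEquiv (f := ε) fun q => map_ratCast ε q
  apply le_antisymm
  · refine normalClosure_le_iff.2 fun s => ?_
    have hs : s.fieldRange ≤ (s.comp (εa.symm : K' →ₐ[ℚ] K)).fieldRange := by
      rintro x ⟨y, rfl⟩
      exact ⟨εa y, by simp⟩
    exact hs.trans (AlgHom.fieldRange_le_normalClosure _)
  · refine normalClosure_le_iff.2 fun s => ?_
    have hs : s.fieldRange ≤ (s.comp (εa : K →ₐ[ℚ] K')).fieldRange := by
      rintro x ⟨y, rfl⟩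
      exact ⟨εa.symm y, by simp⟩
    exact hs.trans (AlgHom.fieldRange_le_normalClosure _)

omit [NumberField L] [NumberField L'] in
/-- **A totally complex quadratic subfield of `K` embedding in `L` transports along isomorphisms `K ≃ K′`, `L ≃ L′`.** [cite: Lang2002, VI §1 Cor. 1.6] -/
theorem exists_quadratic_subfield_of_ringEquiv (εK : K ≃+* K') (εL : L ≃+* L')
    (h : ∃ F : IntermediateField ℚ K, Module.finrank ℚ F = 2 ∧ IsTotallyComplex F ∧ Nonempty (F →+* L)) :
    ∃ F' : IntermediateField ℚ K', Module.finrank ℚ F' = 2 ∧ IsTotallyComplex F' ∧ Nonempty (F' →+* L') := by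
  obtain ⟨F, hF2, hFtc, ⟨g⟩⟩ := h
  haveI := hFtc
  let f : ↥F →ₐ[ℚ] K' := (εK.toRingHom.comp F.val.toRingHom).toRatAlgHom
  have h1 : Module.finrank ℚ ↥f.fieldRange = Module.finrank ℚ ↥F := ((AlgEquiv.ofInjectiveField f).toLinearEquiv.finrank_eq).symm
  let ε : ↥f.fieldRange ≃+* ↥F := (AlgEquiv.ofInjectiveField f).symm.toRingEquiv
  refine ⟨f.fieldRange, h1.trans hF2, ?_, ⟨εL.toRingHom.comp (g.comp ε.toRingHom)⟩⟩
  letI : Algebra (↥F) ↥f.fieldRange := ε.symm.toRingHom.toAlgebra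
  exact isTotallyComplex_of_algebra (↥F) _

end Transport

/-! ## §1 The witnessed forms -/

section OnTheVariety

variable {X : AbelianVariety ℂ}

/-- **MAIN THEOREM (on the variety, witnessed) — PAIRWISE SEPARATED THREEFOLD FACTORS, NO DIHEDRAL SURFACE TRIPLE, ANY ELLIPTIC FACTORS, given ONLY Markman's fourfold theorem.**
`X` of CM type; (a) simple isogeny factors of dimension `≤ 3`; (b) for any two NON-isogenous simple threefold factors there EXIST CM realisations `B₀ ⊨ (K₀; Φ₀)`,
`B₁ ⊨ (K₁; Φ₁)` with different Galois closures and no totally complex quadratic `F ≤ K₀` embedding in `K₁`; (c) for any three pairwise non-isogenous simple surface factors there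
EXIST CM realisations whose fields do not share one Galois closure.  Then everything dominated by a power `X^{N+1}` satisfies the Hodge conjecture.  `HC_CM` is NOT asserted.
[cite: MilneCM2006, Ch. I Prop. 3.13] [cite: Milne1999LefschetzClasses, §1 Prop. 1.1] [cite: MoonenZarhin1999LowDim, Thm. (0.1), (0.2), §3 (3.1), Cor. (3.9)] [cite: Markman2025SurveySecant, Thm. 1.2] -/
theorem hodgeConjectureFor_of_avDominatedBy_powSucc_of_isOfCMType_of_witnessed_separated_threefold_factors_of_markman
    (hW4 : Markman2025_weilClasses_algebraic_abelianFourfold) (hcm : IsOfCMType X)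
    (h3 : ∀ B : AbelianVariety ℂ, B.IsSimple → AVDominatedBy B X → B.dim ≤ 3)
    (hT : ∀ B₀ B₁ : AbelianVariety ℂ, B₀.IsSimple → B₁.IsSimple → AVDominatedBy B₀ X → AVDominatedBy B₁ X → B₀.dim = 3 → B₁.dim = 3 → ¬ IsIsogenous B₀ B₁ →
      ∃ (K₀ : Type) (_ : Field K₀) (_ : NumberField K₀) (_ : IsCMField K₀) (Φ₀ : CMType K₀) (ι₀ : 𝓞 K₀ →+* End B₀) (θ₀ : K₀ →+* Module.End ℂ (complexBetti B₀.X 1))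
        (K₁ : Type) (_ : Field K₁) (_ : NumberField K₁) (_ : IsCMField K₁) (Φ₁ : CMType K₁) (ι₁ : 𝓞 K₁ →+* End B₁) (θ₁ : K₁ →+* Module.End ℂ (complexBetti B₁.X 1)),
        IsCMTypeRealisation Φ₀ B₀ ι₀ θ₀ ∧ IsCMTypeRealisation Φ₁ B₁ ι₁ θ₁ ∧
          normalClosure ℚ K₀ ℂ ≠ normalClosure ℚ K₁ ℂ ∧ ¬ ∃ F : IntermediateField ℚ K₀, Module.finrank ℚ F = 2 ∧ IsTotallyComplex F ∧ Nonempty (F →+* K₁))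
    (hS : ∀ B₀ B₁ B₂ : AbelianVariety ℂ, B₀.IsSimple → B₁.IsSimple → B₂.IsSimple → AVDominatedBy B₀ X → AVDominatedBy B₁ X → AVDominatedBy B₂ X →
      B₀.dim = 2 → B₁.dim = 2 → B₂.dim = 2 → ¬ IsIsogenous B₀ B₁ → ¬ IsIsogenous B₀ B₂ → ¬ IsIsogenous B₁ B₂ →
      ∃ (K₀ : Type) (_ : Field K₀) (_ : NumberField K₀) (_ : IsCMField K₀) (Φ₀ : CMType K₀) (ι₀ : 𝓞 K₀ →+* End B₀) (θ₀ : K₀ →+* Module.End ℂ (complexBetti B₀.X 1))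
        (K₁ : Type) (_ : Field K₁) (_ : NumberField K₁) (_ : IsCMField K₁) (Φ₁ : CMType K₁) (ι₁ : 𝓞 K₁ →+* End B₁) (θ₁ : K₁ →+* Module.End ℂ (complexBetti B₁.X 1))
        (K₂ : Type) (_ : Field K₂) (_ : NumberField K₂) (_ : IsCMField K₂) (Φ₂ : CMType K₂) (ι₂ : 𝓞 K₂ →+* End B₂) (θ₂ : K₂ →+* Module.End ℂ (complexBetti B₂.X 1)),
        IsCMTypeRealisation Φ₀ B₀ ι₀ θ₀ ∧ IsCMTypeRealisation Φ₁ B₁ ι₁ θ₁ ∧ IsCMTypeRealisation Φ₂ B₂ ι₂ θ₂ ∧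
          ¬ (normalClosure ℚ K₀ ℂ = normalClosure ℚ K₁ ℂ ∧ normalClosure ℚ K₁ ℂ = normalClosure ℚ K₂ ℂ))
    {B : AbelianVariety ℂ} {N : ℕ} (hB : AVDominatedBy B (X.powSucc N)) : HodgeConjectureFor B.dim B.X := by
  refine hodgeConjectureFor_of_avDominatedBy_powSucc_of_isOfCMType_of_separated_threefold_factors_of_markman hW4 hcm h3 ?_ ?_ hB
  · intro B₀ B₁ hs₀ hs₁ hd₀ hd₁ h3₀ h3₁ hni K₀ _ _ _ Φ₀ ι₀ θ₀ K₁ _ _ _ Φ₁ ι₁ θ₁ hA₀ hA₁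
    obtain ⟨K₀', _, _, _, Φ₀', ι₀', θ₀', K₁', _, _, _, Φ₁', ι₁', θ₁', hA₀', hA₁', hL, hno⟩ := hT B₀ B₁ hs₀ hs₁ hd₀ hd₁ h3₀ h3₁ hni
    -- the fields of two realisations of one simple variety are isomorphic
    obtain ⟨ε₀, -⟩ := exists_ringEquiv_forall_mem_iff_of_isIsogenous hA₀ hA₀' hs₀ (IsIsogenous.refl _)
    obtain ⟨ε₁, -⟩ := exists_ringEquiv_forall_mem_iff_of_isIsogenous hA₁ hA₁' hs₁ (IsIsogenous.refl _)
    refine ⟨fun h => hL ?_, fun h => hno (exists_quadratic_subfield_of_ringEquiv ε₀ ε₁ h)⟩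
    rw [← normalClosure_eq_of_ringEquiv ε₀, ← normalClosure_eq_of_ringEquiv ε₁, h]
  · intro B₀ B₁ B₂ hs₀ hs₁ hs₂ hd₀ hd₁ hd₂ h2₀ h2₁ h2₂ hn₀₁ hn₀₂ hn₁₂ K₀ _ _ _ Φ₀ ι₀ θ₀ K₁ _ _ _ Φ₁ ι₁ θ₁ K₂ _ _ _ Φ₂ ι₂ θ₂ hA₀ hA₁ hA₂ h
    obtain ⟨K₀', _, _, _, Φ₀', ι₀', θ₀', K₁', _, _, _, Φ₁', ι₁', θ₁', K₂', _, _, _, Φ₂', ι₂', θ₂', hA₀', hA₁', hA₂', hL⟩ :=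
      hS B₀ B₁ B₂ hs₀ hs₁ hs₂ hd₀ hd₁ hd₂ h2₀ h2₁ h2₂ hn₀₁ hn₀₂ hn₁₂
    obtain ⟨ε₀, -⟩ := exists_ringEquiv_forall_mem_iff_of_isIsogenous hA₀ hA₀' hs₀ (IsIsogenous.refl _)
    obtain ⟨ε₁, -⟩ := exists_ringEquiv_forall_mem_iff_of_isIsogenous hA₁ hA₁' hs₁ (IsIsogenous.refl _)
    obtain ⟨ε₂, -⟩ := exists_ringEquiv_forall_mem_iff_of_isIsogenous hA₂ hA₂' hs₂ (IsIsogenous.refl _)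
    apply hL
    rw [← normalClosure_eq_of_ringEquiv ε₀, ← normalClosure_eq_of_ringEquiv ε₁, ← normalClosure_eq_of_ringEquiv ε₂]
    exact h

/-- **ON THE VARIETY, witnessed — AT MOST TWO THREEFOLD CLASSES, NO DIHEDRAL SURFACE TRIPLE (checked on some realisations), ANY ELLIPTIC FACTORS.**
[cite: MilneCM2006, Ch. I Prop. 3.13] [cite: MoonenZarhin1999LowDim, Thm. (0.1), (0.2), §3 (3.1), Cor. (3.9)] [cite: Markman2025SurveySecant, Thm. 1.2] -/
theorem hodgeConjectureFor_of_avDominatedBy_powSucc_of_isOfCMType_of_atMostTwo_threefold_classes_witnessed_noDihedralTriple_of_markman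
    (hW4 : Markman2025_weilClasses_algebraic_abelianFourfold) (hcm : IsOfCMType X)
    (h3 : ∀ B : AbelianVariety ℂ, B.IsSimple → AVDominatedBy B X → B.dim ≤ 3)
    (hT : ∀ B₀ B₁ B₂ : AbelianVariety ℂ, B₀.IsSimple → B₁.IsSimple → B₂.IsSimple → AVDominatedBy B₀ X → AVDominatedBy B₁ X → AVDominatedBy B₂ X →
      B₀.dim = 3 → B₁.dim = 3 → B₂.dim = 3 → IsIsogenous B₀ B₁ ∨ IsIsogenous B₀ B₂ ∨ IsIsogenous B₁ B₂)
    (hS : ∀ B₀ B₁ B₂ : AbelianVariety ℂ, B₀.IsSimple → B₁.IsSimple → B₂.IsSimple → AVDominatedBy B₀ X → AVDominatedBy B₁ X → AVDominatedBy B₂ X →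
      B₀.dim = 2 → B₁.dim = 2 → B₂.dim = 2 → ¬ IsIsogenous B₀ B₁ → ¬ IsIsogenous B₀ B₂ → ¬ IsIsogenous B₁ B₂ →
      ∃ (K₀ : Type) (_ : Field K₀) (_ : NumberField K₀) (_ : IsCMField K₀) (Φ₀ : CMType K₀) (ι₀ : 𝓞 K₀ →+* End B₀) (θ₀ : K₀ →+* Module.End ℂ (complexBetti B₀.X 1))
        (K₁ : Type) (_ : Field K₁) (_ : NumberField K₁) (_ : IsCMField K₁) (Φ₁ : CMType K₁) (ι₁ : 𝓞 K₁ →+* End B₁) (θ₁ : K₁ →+* Module.End ℂ (complexBetti B₁.X 1))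
        (K₂ : Type) (_ : Field K₂) (_ : NumberField K₂) (_ : IsCMField K₂) (Φ₂ : CMType K₂) (ι₂ : 𝓞 K₂ →+* End B₂) (θ₂ : K₂ →+* Module.End ℂ (complexBetti B₂.X 1)),
        IsCMTypeRealisation Φ₀ B₀ ι₀ θ₀ ∧ IsCMTypeRealisation Φ₁ B₁ ι₁ θ₁ ∧ IsCMTypeRealisation Φ₂ B₂ ι₂ θ₂ ∧
          ¬ (normalClosure ℚ K₀ ℂ = normalClosure ℚ K₁ ℂ ∧ normalClosure ℚ K₁ ℂ = normalClosure ℚ K₂ ℂ))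
    {B : AbelianVariety ℂ} {N : ℕ} (hB : AVDominatedBy B (X.powSucc N)) : HodgeConjectureFor B.dim B.X := by
  refine hodgeConjectureFor_of_avDominatedBy_powSucc_of_isOfCMType_of_atMostTwo_threefold_classes_noDihedralTriple_of_markman hW4 hcm h3 hT ?_ hB
  intro B₀ B₁ B₂ hs₀ hs₁ hs₂ hd₀ hd₁ hd₂ h2₀ h2₁ h2₂ hn₀₁ hn₀₂ hn₁₂ K₀ _ _ _ Φ₀ ι₀ θ₀ K₁ _ _ _ Φ₁ ι₁ θ₁ K₂ _ _ _ Φ₂ ι₂ θ₂ hA₀ hA₁ hA₂ h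
  obtain ⟨K₀', _, _, _, Φ₀', ι₀', θ₀', K₁', _, _, _, Φ₁', ι₁', θ₁', K₂', _, _, _, Φ₂', ι₂', θ₂', hA₀', hA₁', hA₂', hL⟩ :=
    hS B₀ B₁ B₂ hs₀ hs₁ hs₂ hd₀ hd₁ hd₂ h2₀ h2₁ h2₂ hn₀₁ hn₀₂ hn₁₂
  obtain ⟨ε₀, -⟩ := exists_ringEquiv_forall_mem_iff_of_isIsogenous hA₀ hA₀' hs₀ (IsIsogenous.refl _)
  obtain ⟨ε₁, -⟩ := exists_ringEquiv_forall_mem_iff_of_isIsogenous hA₁ hA₁' hs₁ (IsIsogenous.refl _)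
  obtain ⟨ε₂, -⟩ := exists_ringEquiv_forall_mem_iff_of_isIsogenous hA₂ hA₂' hs₂ (IsIsogenous.refl _)
  apply hL
  rw [← normalClosure_eq_of_ringEquiv ε₀, ← normalClosure_eq_of_ringEquiv ε₁, ← normalClosure_eq_of_ringEquiv ε₂]
  exact h

end OnTheVariety

end Summit.HodgeConjecture.CorCM.MultiFieldWeil

end
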